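import Mathlib
import Literature.MathematicalPhysics.QuantumFieldTheory.Balaban1983to89.Beta.AveragingThirdJet

/-!
# MultilinearJet — the analytic meaning of node 12's nilpotent letter algebra `Rho 𝔸 = 𝔸[τ₁,τ₂][ρ]`
(β sub-cell «direct one-loop in Bałaban's gauge», an1 node 12c, part 1 of 4 — files 1 `MultilinearJet`, 1b `MultilinearJetUnique`,
2 `MultilinearJetExpLog`, 3 `MultilinearJetAveraging`)

HONEST FRAMING.  Discharging `BetaPertH` would make Bałaban's UV stability UNCONDITIONAL — a constructive-QFT
result; it is NOT the continuum limit and NOT the Clay problem.  This file discharges nothing of it: it is pure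
calculus (Mathlib + node 12's algebra `Literature/…/Beta/AveragingThirdJet`), the first part of the an1-side
identification «formal jets of nodes 12/12b = multilinear Taylor coefficients at `0` of the genuine Banach-algebra
averaging map composed with the exponential chart» (node 12's header says that link «is NOT typed» there).
ABSOLUTE RULE respected: nothing is cited, nothing is asserted about the manuscripts under audit.  [folklore]

## Content

Parameters `x = (s, t₁, t₂) ∈ ℂ³` (`P3`), values in a normed `ℂ`-algebra `𝔸` (noncommutative allowed).

* `evT a x = a₀₀ + t₁•a₁₀ + t₂•a₀₁ + t₁t₂•a₁₁` and `ev q x = evT q.fst x + s • evT q.snd x`: the square-free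
  (multilinear) polynomial germ attached to an element of node 12's `Tau 𝔸` / `Rho 𝔸`.
* `flat : Set (P3 → 𝔸)`, the FLAT functions: near `0`, `R x = s²•r₀ x + t₁²•r₁ x + t₂²•r₂ x` with `rᵢ` analytic
  at `0` — the ideal `(s², t₁², t₂²)` of analytic germs, i.e. exactly the relations `ρ² = τ₁² = τ₂² = 0` of `Rho 𝔸`.
* `jets f : Set (Rho 𝔸)`, `q ∈ jets f :↔ (f − ev q) ∈ flat`: «`q` is a multilinear 3-jet of `f` at `0`».
* THE DICTIONARY IS MULTIPLICATIVE (`mul_mem_jets`: jets multiply in `Rho 𝔸`), additive, `ℂ`-linear, stable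
  under finite sums, and UNIQUE (`jets_subsingleton`: an analytic germ has at most one jet — so «the
  `st₁t₂`-coefficient of `f`», `c11 q.snd`, is intrinsic).  Part 1b (`MultilinearJetUnique`) proves the
  uniqueness; parts 2/3 (`MultilinearJetExpLog`, `MultilinearJetAveraging`) push `exp`, `log`, `⁻¹` and node
  12/12b's averaging maps through it.
  (Both notions are SETS — mathematical objects, not propositions minted under `Summits/`.)
-/

noncomputable section

-- PERF: `Mul (Rho 𝔸)` under `NormedAlgebra ℂ 𝔸` is found, but only past the default synthesis budget.
set_option synthInstance.maxHeartbeats 400000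

open scoped Topology
open Filter
open Literature.MathematicalPhysics.QuantumFieldTheory.Balaban1983to89.Beta.AveragingThirdJet
open Literature.MathematicalPhysics.QuantumFieldTheory.Balaban1983to89.Beta.AveragingThirdJet.Tau

namespace Summit.QuantumFields.BalabanUV.Beta.MultilinearJet

/-- The parameter space `ℂ³`: `x 0 = s` ↔ node 12's outer nilpotent `ρ` (12b: `σ`), `x 1 = t₁` ↔ `τ₁`,
`x 2 = t₂` ↔ `τ₂`. -/
abbrev P3 : Type := Fin 3 → ℂ

variable {𝔸 : Type*} [NormedRing 𝔸] [NormedAlgebra ℂ 𝔸]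

/-! ## §1 The multilinear polynomial germ of a formal jet -/

/-- [folklore] The square-free polynomial `a₀₀ + t₁ a₁₀ + t₂ a₀₁ + t₁t₂ a₁₁` of `a ∈ Tau 𝔸 = 𝔸[τ₁,τ₂]`. -/
def evT (a : Tau 𝔸) (x : P3) : 𝔸 := c00 a + (x 1) • c10 a + (x 2) • c01 a + (x 1 * x 2) • c11 a

/-- [folklore] The square-free polynomial of `q = (a, m) ∈ Rho 𝔸 = (Tau 𝔸)[ρ]`: `evT a + s • evT m`. -/
def ev (q : Rho 𝔸) (x : P3) : 𝔸 := evT q.fst x + (x 0) • evT q.snd x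

/-- At the origin `evT a` is the constant coefficient `c00 a`. -/
@[simp] theorem evT_apply_zero (a : Tau 𝔸) : evT a 0 = c00 a := by simp [evT]

/-- At the origin `ev q` is the constant coefficient `c00 q.fst`. -/
@[simp] theorem ev_apply_zero (q : Rho 𝔸) : ev q 0 = c00 q.fst := by simp [ev]

/-- `evT` is additive. -/
theorem evT_add (a b : Tau 𝔸) (x : P3) : evT (a + b) x = evT a x + evT b x := by
  simp only [evT, c00_add, c10_add, c01_add, c11_add, smul_add]; abel

/-- `evT` commutes with negation. -/
theorem evT_neg (a : Tau 𝔸) (x : P3) : evT (-a) x = -evT a x := by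
  simp only [evT, c00_neg, c10_neg, c01_neg, c11_neg, smul_neg]; abel

/-- `evT` commutes with subtraction. -/
theorem evT_sub (a b : Tau 𝔸) (x : P3) : evT (a - b) x = evT a x - evT b x := by
  simp only [sub_eq_add_neg, evT_add, evT_neg]

/-- `evT` is `ℂ`-homogeneous. -/
theorem evT_smul (r : ℂ) (a : Tau 𝔸) (x : P3) : evT (r • a) x = r • evT a x := by
  simp only [evT, c00_smul, c10_smul, c01_smul, c11_smul]; module

/-- `evT 0 = 0`. -/
@[simp] theorem evT_zero (x : P3) : evT (0 : Tau 𝔸) x = 0 := by simp [evT]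

/-- `evT 1 = 1`. -/
@[simp] theorem evT_one (x : P3) : evT (1 : Tau 𝔸) x = 1 := by simp [evT]

/-- The scalar letter `ι a` evaluates to the constant `a`. -/
@[simp] theorem evT_ι (a : 𝔸) (x : P3) : evT (ι a) x = a := by simp [evT]

/-- `ev` is additive. -/
theorem ev_add (q q' : Rho 𝔸) (x : P3) : ev (q + q') x = ev q x + ev q' x := by
  simp only [ev, TrivSqZeroExt.fst_add, TrivSqZeroExt.snd_add, evT_add, smul_add]; abel

/-- `ev` commutes with negation. -/
theorem ev_neg (q : Rho 𝔸) (x : P3) : ev (-q) x = -ev q x := by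
  simp only [ev, TrivSqZeroExt.fst_neg, TrivSqZeroExt.snd_neg, evT_neg, smul_neg]; abel

/-- `ev` commutes with subtraction. -/
theorem ev_sub (q q' : Rho 𝔸) (x : P3) : ev (q - q') x = ev q x - ev q' x := by
  simp only [sub_eq_add_neg, ev_add, ev_neg]

/-- `ev` is `ℂ`-homogeneous. -/
theorem ev_smul (r : ℂ) (q : Rho 𝔸) (x : P3) : ev (r • q) x = r • ev q x := by
  simp only [ev, TrivSqZeroExt.fst_smul, TrivSqZeroExt.snd_smul, evT_smul]; module

/-- `ev 0 = 0`. -/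
@[simp] theorem ev_zero (x : P3) : ev (0 : Rho 𝔸) x = 0 := by simp [ev]

/-- `ev 1 = 1`. -/
@[simp] theorem ev_one (x : P3) : ev (1 : Rho 𝔸) x = 1 := by simp [ev]

/-- `ev` of a dual number `dmk a m` is `evT a + s • evT m`. -/
@[simp] theorem ev_dmk (a m : Tau 𝔸) (x : P3) : ev (dmk a m) x = evT a x + (x 0) • evT m x := by
  simp [ev, dmk]

/-! ### Analyticity of coordinates and of polynomial germs -/

/-- Coordinate projections of `P3 = ℂ³` are analytic. -/
@[fun_prop] theorem analyticAt_coord (i : Fin 3) (x₀ : P3) : AnalyticAt ℂ (fun x : P3 => x i) x₀ :=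
  (ContinuousLinearMap.proj (R := ℂ) (φ := fun _ : Fin 3 => ℂ) i).analyticAt x₀

/-- The polynomial germ `evT a` is analytic. -/
@[fun_prop] theorem analyticAt_evT (a : Tau 𝔸) (x₀ : P3) : AnalyticAt ℂ (evT a) x₀ := by
  unfold evT; fun_prop

/-- The polynomial germ `ev q` is analytic. -/
@[fun_prop] theorem analyticAt_ev (q : Rho 𝔸) (x₀ : P3) : AnalyticAt ℂ (ev q) x₀ := by
  unfold ev; fun_prop

/-! ## §2 Flat germs: the ideal `(s², t₁², t₂²)` -/

/-- [folklore] The set of functions FLAT at `0`: near `0`, `R = s² r₀ + t₁² r₁ + t₂² r₂` with `rᵢ` analytic at `0`. -/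
def flat : Set (P3 → 𝔸) :=
  {R | ∃ r₀ r₁ r₂ : P3 → 𝔸, AnalyticAt ℂ r₀ 0 ∧ AnalyticAt ℂ r₁ 0 ∧ AnalyticAt ℂ r₂ 0 ∧
    ∀ᶠ x in 𝓝 (0 : P3), R x = (x 0) ^ 2 • r₀ x + (x 1) ^ 2 • r₁ x + (x 2) ^ 2 • r₂ x}

/-- Unfolding lemma for membership in `flat`. -/
theorem mem_flat {R : P3 → 𝔸} : R ∈ flat ↔
    ∃ r₀ r₁ r₂ : P3 → 𝔸, AnalyticAt ℂ r₀ 0 ∧ AnalyticAt ℂ r₁ 0 ∧ AnalyticAt ℂ r₂ 0 ∧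
      ∀ᶠ x in 𝓝 (0 : P3), R x = (x 0) ^ 2 • r₀ x + (x 1) ^ 2 • r₁ x + (x 2) ^ 2 • r₂ x := Iff.rfl

/-- `flat` only depends on the germ at `0`. -/
theorem flat_congr {R S : P3 → 𝔸} (hR : R ∈ flat) (h : ∀ᶠ x in 𝓝 (0 : P3), R x = S x) : S ∈ flat := by
  obtain ⟨r₀, r₁, r₂, h₀, h₁, h₂, hx⟩ := mem_flat.1 hR
  exact mem_flat.2 ⟨r₀, r₁, r₂, h₀, h₁, h₂, by filter_upwards [hx, h] with x hx h; rw [← h, hx]⟩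

/-- `0` is flat. -/
theorem zero_mem_flat : (fun _ : P3 => (0 : 𝔸)) ∈ flat :=
  mem_flat.2 ⟨0, 0, 0, analyticAt_const, analyticAt_const, analyticAt_const,
    Eventually.of_forall fun x => by simp⟩

/-- Flat germs are closed under addition. -/
theorem flat_add {R S : P3 → 𝔸} (hR : R ∈ flat) (hS : S ∈ flat) : (fun x => R x + S x) ∈ flat := by
  obtain ⟨r₀, r₁, r₂, h₀, h₁, h₂, hx⟩ := mem_flat.1 hR
  obtain ⟨s₀, s₁, s₂, k₀, k₁, k₂, hy⟩ := mem_flat.1 hS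
  refine mem_flat.2 ⟨fun x => r₀ x + s₀ x, fun x => r₁ x + s₁ x, fun x => r₂ x + s₂ x,
    by fun_prop, by fun_prop, by fun_prop, ?_⟩
  filter_upwards [hx, hy] with x hx hy
  rw [hx, hy]; module

/-- Flat germs are closed under scalar multiplication. -/
theorem flat_smul {R : P3 → 𝔸} (c : ℂ) (hR : R ∈ flat) : (fun x => c • R x) ∈ flat := by
  obtain ⟨r₀, r₁, r₂, h₀, h₁, h₂, hx⟩ := mem_flat.1 hR
  refine mem_flat.2 ⟨fun x => c • r₀ x, fun x => c • r₁ x, fun x => c • r₂ x,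
    by fun_prop, by fun_prop, by fun_prop, ?_⟩
  filter_upwards [hx] with x hx
  rw [hx]; module

/-- Flat germs are closed under negation. -/
theorem flat_neg {R : P3 → 𝔸} (hR : R ∈ flat) : (fun x => -R x) ∈ flat := by
  simpa using flat_smul (-1) hR

/-- Flat germs are closed under subtraction. -/
theorem flat_sub {R S : P3 → 𝔸} (hR : R ∈ flat) (hS : S ∈ flat) : (fun x => R x - S x) ∈ flat := by
  simpa [sub_eq_add_neg] using flat_add hR (flat_neg hS)

/-- [folklore] The flat germs form a LEFT ideal of the germs analytic at `0` … -/
theorem flat_mul_left {R g : P3 → 𝔸} (hg : AnalyticAt ℂ g 0) (hR : R ∈ flat) : (fun x => g x * R x) ∈ flat := by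
  obtain ⟨r₀, r₁, r₂, h₀, h₁, h₂, hx⟩ := mem_flat.1 hR
  refine mem_flat.2 ⟨fun x => g x * r₀ x, fun x => g x * r₁ x, fun x => g x * r₂ x,
    by fun_prop, by fun_prop, by fun_prop, ?_⟩
  filter_upwards [hx] with x hx
  rw [hx]; simp only [mul_add, mul_smul_comm]

/-- [folklore] … and a RIGHT ideal. -/
theorem flat_mul_right {R g : P3 → 𝔸} (hR : R ∈ flat) (hg : AnalyticAt ℂ g 0) :
    (fun x => R x * g x) ∈ flat := by
  obtain ⟨r₀, r₁, r₂, h₀, h₁, h₂, hx⟩ := mem_flat.1 hR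
  refine mem_flat.2 ⟨fun x => r₀ x * g x, fun x => r₁ x * g x, fun x => r₂ x * g x,
    by fun_prop, by fun_prop, by fun_prop, ?_⟩
  filter_upwards [hx] with x hx
  rw [hx]; simp only [add_mul, smul_mul_assoc]

/-- A flat germ is analytic at `0`. -/
theorem analyticAt_of_mem_flat {R : P3 → 𝔸} (hR : R ∈ flat) : AnalyticAt ℂ R 0 := by
  obtain ⟨r₀, r₁, r₂, h₀, h₁, h₂, hx⟩ := mem_flat.1 hR
  have h : AnalyticAt ℂ (fun x : P3 => (x 0) ^ 2 • r₀ x + (x 1) ^ 2 • r₁ x + (x 2) ^ 2 • r₂ x) 0 := by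
    fun_prop
  exact h.congr (by filter_upwards [hx] with x hx; exact hx.symm)

/-- A flat function vanishes at `0`. -/
theorem apply_zero_of_mem_flat {R : P3 → 𝔸} (hR : R ∈ flat) : R 0 = 0 := by
  obtain ⟨r₀, r₁, r₂, -, -, -, hx⟩ := mem_flat.1 hR
  simpa using hx.self_of_nhds

/-- `xᵢ² • g` is flat for `g` analytic at `0`. -/
theorem sq_smul_mem_flat (i : Fin 3) {g : P3 → 𝔸} (hg : AnalyticAt ℂ g 0) :
    (fun x => (x i) ^ 2 • g x) ∈ flat := by
  fin_cases i
  · exact mem_flat.2 ⟨g, 0, 0, hg, analyticAt_const, analyticAt_const, Eventually.of_forall fun x => by simp⟩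
  · exact mem_flat.2 ⟨0, g, 0, analyticAt_const, hg, analyticAt_const, Eventually.of_forall fun x => by simp⟩
  · exact mem_flat.2 ⟨0, 0, g, analyticAt_const, analyticAt_const, hg, Eventually.of_forall fun x => by simp⟩

/-- `(xᵢ·xᵢ) • g` is flat for `g` analytic at `0`. -/
theorem mul_smul_mem_flat (i : Fin 3) {g : P3 → 𝔸} (hg : AnalyticAt ℂ g 0) :
    (fun x => (x i * x i) • g x) ∈ flat := by
  simpa [pow_two] using sq_smul_mem_flat i hg

/-! ### The product rule: `ev` is multiplicative modulo flat germs -/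

/-- The `t₁²`-bucket of `evT p · evT p'`. -/
def R1 (p p' : Tau 𝔸) (x : P3) : 𝔸 :=
  c10 p * c10 p' + (x 2) • (c10 p * c11 p' + c11 p * c10 p') + (x 2 * x 2) • (c11 p * c11 p')

/-- The `t₂²`-bucket of `evT p · evT p'`. -/
def R2 (p p' : Tau 𝔸) (x : P3) : 𝔸 :=
  c01 p * c01 p' + (x 1) • (c01 p * c11 p' + c11 p * c01 p')

/-- The bucket `R1 p p'` is an analytic (polynomial) germ. -/
@[fun_prop] theorem analyticAt_R1 (p p' : Tau 𝔸) (x₀ : P3) : AnalyticAt ℂ (R1 p p') x₀ := by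
  unfold R1; fun_prop

/-- The bucket `R2 p p'` is an analytic (polynomial) germ. -/
@[fun_prop] theorem analyticAt_R2 (p p' : Tau 𝔸) (x₀ : P3) : AnalyticAt ℂ (R2 p p') x₀ := by
  unfold R2; fun_prop

/-- [folklore] `evT p · evT p' = evT (p p') + t₁² R₁ + t₂² R₂` — the relations `τ₁² = τ₂² = 0`, analytically. -/
theorem evT_mul (p p' : Tau 𝔸) (x : P3) :
    evT p x * evT p' x = evT (p * p') x + (x 1 * x 1) • R1 p p' x + (x 2 * x 2) • R2 p p' x := by
  simp only [evT, R1, R2, c00_mul, c10_mul, c01_mul, c11_mul, mul_add, add_mul, smul_add, smul_mul_assoc,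
    mul_smul_comm, smul_smul]
  module

/-- The explicit flat remainder of `ev q · ev q' − ev (q q')`. -/
theorem ev_mul_sub (q q' : Rho 𝔸) (x : P3) : ev q x * ev q' x - ev (q * q') x
    = (x 1 * x 1) • (R1 q.fst q'.fst x + (x 0) • (R1 q.fst q'.snd x + R1 q.snd q'.fst x))
      + (x 2 * x 2) • (R2 q.fst q'.fst x + (x 0) • (R2 q.fst q'.snd x + R2 q.snd q'.fst x))
      + (x 0 * x 0) • (evT q.snd x * evT q'.snd x) := by
  have e1 := evT_mul q.fst q'.fst x
  have e2 := evT_mul q.fst q'.snd x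
  have e3 := evT_mul q.snd q'.fst x
  simp only [ev, dfst_mul, dsnd_mul, evT_add, mul_add, add_mul, smul_add, smul_mul_assoc, mul_smul_comm,
    smul_smul, e1, e2, e3]
  module

/-- [folklore] THE PRODUCT RULE: `ev q · ev q' − ev (q q')` is flat (the relations `ρ² = τ₁² = τ₂² = 0`). -/
theorem ev_mul_sub_mem_flat (q q' : Rho 𝔸) : (fun x => ev q x * ev q' x - ev (q * q') x) ∈ flat := by
  have h1 : (fun x : P3 => (x 1 * x 1) •
      (R1 q.fst q'.fst x + (x 0) • (R1 q.fst q'.snd x + R1 q.snd q'.fst x))) ∈ flat :=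
    mul_smul_mem_flat 1 (by fun_prop)
  have h2 : (fun x : P3 => (x 2 * x 2) •
      (R2 q.fst q'.fst x + (x 0) • (R2 q.fst q'.snd x + R2 q.snd q'.fst x))) ∈ flat :=
    mul_smul_mem_flat 2 (by fun_prop)
  have h3 : (fun x : P3 => (x 0 * x 0) • (evT q.snd x * evT q'.snd x)) ∈ flat :=
    mul_smul_mem_flat 0 (by fun_prop)
  exact flat_congr (flat_add (flat_add h1 h2) h3) (Eventually.of_forall fun x => (ev_mul_sub q q' x).symm)

/-! ## §3 Jets -/

/-- [folklore] The set of MULTILINEAR 3-JETS OF `f` AT `0`: those `q ∈ Rho 𝔸` with `f − ev q` flat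
(at most one element: `jets_subsingleton`). -/
def jets (f : P3 → 𝔸) : Set (Rho 𝔸) := {q | (fun x => f x - ev q x) ∈ flat}

section Jets

variable {f g : P3 → 𝔸} {q q' : Rho 𝔸}

/-- Unfolding lemma for membership in `jets f`. -/
theorem mem_jets : q ∈ jets f ↔ (fun x => f x - ev q x) ∈ flat := Iff.rfl

/-- `jets f` only depends on the germ of `f` at `0`. -/
theorem jets_congr (hf : q ∈ jets f) (h : ∀ᶠ x in 𝓝 (0 : P3), f x = g x) : q ∈ jets g :=
  mem_jets.2 (flat_congr (mem_jets.1 hf) (by filter_upwards [h] with x hx; simp only [hx]))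

/-- A germ with a jet is analytic at `0`. -/
theorem analyticAt_of_mem_jets (hf : q ∈ jets f) : AnalyticAt ℂ f 0 :=
  ((analyticAt_of_mem_flat (mem_jets.1 hf)).add (analyticAt_ev q 0)).congr
    (Eventually.of_forall fun x => by simp)

/-- The value at `0` is the constant coefficient. -/
theorem apply_zero_of_mem_jets (hf : q ∈ jets f) : f 0 = c00 q.fst := by
  have h := apply_zero_of_mem_flat (mem_jets.1 hf)
  simp only [ev_apply_zero, sub_eq_zero] at h
  exact h

/-- Jets add. -/
theorem add_mem_jets (hf : q ∈ jets f) (hg : q' ∈ jets g) : q + q' ∈ jets (fun x => f x + g x) :=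
  mem_jets.2 (flat_congr (flat_add (mem_jets.1 hf) (mem_jets.1 hg))
    (Eventually.of_forall fun x => by simp only [ev_add]; abel))

/-- Jets commute with negation. -/
theorem neg_mem_jets (hf : q ∈ jets f) : -q ∈ jets (fun x => -f x) :=
  mem_jets.2 (flat_congr (flat_neg (mem_jets.1 hf)) (Eventually.of_forall fun x => by simp only [ev_neg]; abel))

/-- Jets subtract. -/
theorem sub_mem_jets (hf : q ∈ jets f) (hg : q' ∈ jets g) : q - q' ∈ jets (fun x => f x - g x) :=
  mem_jets.2 (flat_congr (flat_sub (mem_jets.1 hf) (mem_jets.1 hg))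
    (Eventually.of_forall fun x => by simp only [ev_sub]; abel))

/-- Jets are `ℂ`-homogeneous. -/
theorem smul_mem_jets (c : ℂ) (hf : q ∈ jets f) : c • q ∈ jets (fun x => c • f x) :=
  mem_jets.2 (flat_congr (flat_smul c (mem_jets.1 hf))
    (Eventually.of_forall fun x => by simp only [ev_smul, smul_sub]))

/-- [folklore] THE PRODUCT RULE: jets multiply in `Rho 𝔸`. -/
theorem mul_mem_jets (hf : q ∈ jets f) (hg : q' ∈ jets g) : q * q' ∈ jets (fun x => f x * g x) := by
  have h1 : (fun x => (f x - ev q x) * g x) ∈ flat := flat_mul_right (mem_jets.1 hf) (analyticAt_of_mem_jets hg)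
  have h2 : (fun x => ev q x * (g x - ev q' x)) ∈ flat := flat_mul_left (analyticAt_ev q 0) (mem_jets.1 hg)
  exact mem_jets.2 (flat_congr (flat_add (flat_add h1 h2) (ev_mul_sub_mem_flat q q'))
    (Eventually.of_forall fun x => by noncomm_ring))

/-- Jets of finite sums are the sums of the jets. -/
theorem sum_mem_jets {ι' : Type*} {F : ι' → P3 → 𝔸} {Q : ι' → Rho 𝔸} (s : Finset ι')
    (h : ∀ i ∈ s, Q i ∈ jets (F i)) : ∑ i ∈ s, Q i ∈ jets (fun x => ∑ i ∈ s, F i x) := by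
  induction s using Finset.cons_induction with
  | empty => exact mem_jets.2 (flat_congr zero_mem_flat (Eventually.of_forall fun x => by simp))
  | cons i s hi ih =>
    have h' := add_mem_jets (h i (Finset.mem_cons_self i s)) (ih fun j hj => h j (Finset.mem_cons_of_mem hj))
    simp only [Finset.sum_cons]
    exact h'

end Jets

/-- [folklore] A constant has jet `ι a` (node 12's scalar letter). -/
theorem const_mem_jets (a : 𝔸) : dmk (ι a) 0 ∈ jets (fun _ : P3 => a) :=
  mem_jets.2 (flat_congr zero_mem_flat (Eventually.of_forall fun x => by simp))

/-- The constant `1` has jet `1`. -/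
theorem one_mem_jets : (1 : Rho 𝔸) ∈ jets (fun _ : P3 => (1 : 𝔸)) :=
  mem_jets.2 (flat_congr zero_mem_flat (Eventually.of_forall fun x => by simp))

/-- The constant `0` has jet `0`. -/
theorem zero_mem_jets : (0 : Rho 𝔸) ∈ jets (fun _ : P3 => (0 : 𝔸)) :=
  mem_jets.2 (flat_congr zero_mem_flat (Eventually.of_forall fun x => by simp))

/-- [folklore] The coordinate germ `x ↦ s • a` has jet `ρ ι a`. -/
theorem smul_s_mem_jets (a : 𝔸) : dmk 0 (ι a) ∈ jets (fun x : P3 => (x 0) • a) :=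
  mem_jets.2 (flat_congr zero_mem_flat (Eventually.of_forall fun x => by simp))

/-- [folklore] The coordinate germ `x ↦ t₁ • a` has jet `τ₁ ι a`. -/
theorem smul_t1_mem_jets (a : 𝔸) : dmk (τ₁ * ι a) 0 ∈ jets (fun x : P3 => (x 1) • a) :=
  mem_jets.2 (flat_congr zero_mem_flat (Eventually.of_forall fun x => by simp [evT]))

/-- [folklore] The coordinate germ `x ↦ t₂ • a` has jet `τ₂ ι a`. -/
theorem smul_t2_mem_jets (a : 𝔸) : dmk (τ₂ * ι a) 0 ∈ jets (fun x : P3 => (x 2) • a) :=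
  mem_jets.2 (flat_congr zero_mem_flat (Eventually.of_forall fun x => by simp [evT]))

end Summit.QuantumFields.BalabanUV.Beta.MultilinearJet

end
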